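import Mathlib.LinearAlgebra.LinearIndependent.Lemmas
import Mathlib.LinearAlgebra.FiniteDimensional.Lemmas
import Mathlib.RingTheory.Noetherian.Basic
import Mathlib.Algebra.Algebra.Subalgebra.Lattice
import Mathlib.RingTheory.Adjoin.Basic
import Mathlib.GroupTheory.Index
import HarnessLib

/-!
# Eigensystems of common eigenvectors: finiteness, semilinear transport, finite-index stabilisers

Topic `LinearAlgebra/Semilinear`; theorems only (no definition, no named fact).

Let `H` be a finite-dimensional vector space over a field `C` and `(S i)_{i ∈ ι}` ANY family of
`C`-linear endomorphisms of `H` (no commutativity assumed, any index set). A *system of eigenvalues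
of a common eigenvector* is a function `χ : ι → C` for which some `y ≠ 0` has `S i y = χ i • y`
for all `i`.

* `exists_algHom_apply_eq_smul_of_common_eigenvector` — the **eigencharacter**: such a `y` is an
  eigenvector of every element of the subalgebra `C[S] = Algebra.adjoin C (range S)` of `End_C H`,
  and the eigenvalue is a `C`-algebra homomorphism `ψ : C[S] → C` with `ψ (S i) = χ i`.
* `finite_algHom_of_finiteDimensional` — a finite-dimensional `C`-algebra has finitely many
  `C`-algebra homomorphisms to `C` (Dedekind–Artin independence of characters, Mathlib
  `linearIndependent_algHom_toLinearMap`, inside the finite-dimensional dual).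
* `finite_setOf_common_eigensystem` — hence **only finitely many systems of eigenvalues of common
  eigenvectors occur in `H`** (`χ ↦ ψ` is injective and `C[S]` is finite-dimensional).
* `apply_semilinear_eq_smul` — **semilinear transport**: if `θ : H → H` is `σ`-semilinear
  (`σ : C →+* C`) and commutes with every `S i`, then `θ y` is a common eigenvector with the
  conjugate system `σ ∘ χ`; `finite_range_comp_eigensystem` — so for a family of injective such
  `θ_g` (`g ∈ G`) the set of conjugate systems `{σ_g ∘ χ}` is finite.
* `finiteIndex_of_finite_range` (group theory: a map out of a group that is constant exactly on the
  left cosets of a subgroup and has finite range forces finite index) and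
  `exists_stabilizer_finiteIndex_of_semilinear` — for a group `G` acting on `C` through ring
  endomorphisms `σ_g` and on `H` through injective `σ_g`-semilinear maps commuting with the `S i`,
  **the stabiliser `{g | σ_g ∘ χ = χ}` of the system of a common eigenvector has finite index in `G`**.

This is the linear algebra of the "`σ`-twisting" argument for rationality fields: Grobner–Raghuram
2014 (arXiv:1102.1872), Thm. 50 / Thm. 8.1 ("`σ ↦ ^σΠ_f` has finite image in the finite-dimensional
cohomology `H^b(S, ℰ_μ)`, so the stabiliser of `Π_f` in `Aut(ℂ)` has finite index and `ℚ(Π_f)` is a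
number field", after Clozel 1990, §3.1 and Thm. 3.13; Waldspurger 1985, I.8; Hungerford, *Algebra*,
V Lemma 2.9 for the Artin step), with the automorphic input (a semilinear `Aut(ℂ/E)`-action on a
finite-dimensional Hecke module containing the eigensystem) left to the user; consumer:
`Literature.NumberTheory.Automorphic.heckeEigenvalue_mem_subfield_of_semilinearAction`
(`ClozelAlgebraicityHeckeFieldProofs`).

## References

* H. Grobner, A. Raghuram, *On some arithmetic properties of automorphic forms of GL_m over a
  division algebra*, Int. J. Number Theory 10 (2014) = arXiv:1102.1872, §8, Thm. 50 (arXiv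
  numbering; held text `paper:arxiv-1102.1872`). [GrobnerRaghuram2014]
* L. Clozel, *Motifs et formes automorphes: applications du principe de fonctorialité* (1990),
  §3.1. [Clozel1990]
* N. Bourbaki, *Algebra II*, Ch. V §10 (Dedekind's independence of characters); Mathlib
  `linearIndependent_algHom_toLinearMap` (Stacks 0CKM).
-/

noncomputable section

namespace Literature.LinearAlgebra.Semilinear

section Eigencharacter

variable {C : Type*} [Field C] {H : Type*} [AddCommGroup H] [Module C H]

/-- **The eigencharacter of a common eigenvector.** If `y ≠ 0` satisfies `S i y = χ i • y` for all
`i`, then `y` is an eigenvector of every element of `C[S] = Algebra.adjoin C (range S) ⊆ End_C H`,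
the eigenvalue being a `C`-algebra homomorphism `ψ : C[S] →ₐ[C] C` with `ψ (S i) = χ i` (the
endomorphisms having `y` as an eigenvector form a subalgebra containing the `S i`; the eigenvalue on
it is multiplicative and additive since `y ≠ 0`). [folklore] -/
theorem exists_algHom_apply_eq_smul_of_common_eigenvector {ι : Type*} (S : ι → Module.End C H)
    (χ : ι → C) {y : H} (hy : y ≠ 0) (h : ∀ i, S i y = χ i • y) :
    ∃ ψ : Algebra.adjoin C (Set.range S) →ₐ[C] C,
      (∀ a : Algebra.adjoin C (Set.range S), (a : Module.End C H) y = ψ a • y) ∧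
      ∀ (i : ι) (hi : S i ∈ Algebra.adjoin C (Set.range S)), ψ ⟨S i, hi⟩ = χ i := by
  -- uniqueness of the eigenvalue on the non-zero vector `y`
  have huniq : ∀ c c' : C, c • y = c' • y → c = c' := fun c c' hcc' ↦
    smul_left_injective C hy hcc'
  -- the subalgebra of endomorphisms having `y` as an eigenvector
  let B : Subalgebra C (Module.End C H) :=
    { carrier := {a | ∃ c : C, a y = c • y}
      mul_mem' := by
        rintro a b ⟨ca, ha⟩ ⟨cb, hb⟩
        refine ⟨ca * cb, ?_⟩
        rw [Module.End.mul_apply, hb, LinearMap.map_smul, ha, smul_smul, mul_comm]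
      one_mem' := ⟨1, by rw [Module.End.one_apply, one_smul]⟩
      add_mem' := by
        rintro a b ⟨ca, ha⟩ ⟨cb, hb⟩
        exact ⟨ca + cb, by rw [LinearMap.add_apply, ha, hb, add_smul]⟩
      zero_mem' := ⟨0, by rw [LinearMap.zero_apply, zero_smul]⟩
      algebraMap_mem' := fun r ↦ ⟨r, by
        rw [Algebra.algebraMap_eq_smul_one, LinearMap.smul_apply, Module.End.one_apply]⟩ }
  have hmemB : ∀ {a : Module.End C H}, a ∈ B ↔ ∃ c : C, a y = c • y := fun {a} ↦ Iff.rfl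
  have hle : Algebra.adjoin C (Set.range S) ≤ B := by
    refine Algebra.adjoin_le ?_
    rintro _ ⟨i, rfl⟩
    exact ⟨χ i, h i⟩
  -- the eigencharacter
  choose ψ hψ using fun a : Algebra.adjoin C (Set.range S) ↦ hmemB.mp (hle a.2)
  have hψ_eq : ∀ (a : Algebra.adjoin C (Set.range S)) (c : C),
      (a : Module.End C H) y = c • y → ψ a = c :=
    fun a c hc ↦ huniq _ _ ((hψ a).symm.trans hc)
  let ψa : Algebra.adjoin C (Set.range S) →ₐ[C] C :=
    { toFun := ψ
      map_one' := hψ_eq 1 1 (by rw [Subalgebra.coe_one, Module.End.one_apply, one_smul])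
      map_mul' := fun a b ↦ hψ_eq (a * b) (ψ a * ψ b) (by
        rw [Subalgebra.coe_mul, Module.End.mul_apply, hψ b, LinearMap.map_smul, hψ a, smul_smul,
          mul_comm])
      map_zero' := hψ_eq 0 0 (by rw [Subalgebra.coe_zero, LinearMap.zero_apply, zero_smul])
      map_add' := fun a b ↦ hψ_eq (a + b) (ψ a + ψ b) (by
        rw [Subalgebra.coe_add, LinearMap.add_apply, hψ a, hψ b, add_smul])
      commutes' := fun r ↦ hψ_eq (algebraMap C _ r) r (by
        rw [Subalgebra.coe_algebraMap, Algebra.algebraMap_eq_smul_one, LinearMap.smul_apply,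
          Module.End.one_apply]) }
  refine ⟨ψa, fun a ↦ hψ a, fun i hi ↦ ?_⟩
  exact hψ_eq ⟨S i, hi⟩ (χ i) (h i)

/-- **A finite-dimensional algebra over a field has finitely many algebra homomorphisms to the
field**: distinct `C`-algebra homomorphisms `A → C` are linearly independent in the
finite-dimensional dual `A →ₗ[C] C` (Dedekind–Artin, Mathlib `linearIndependent_algHom_toLinearMap`).
[folklore] -/
theorem finite_algHom_of_finiteDimensional (A : Type*) [Ring A] [Algebra C A]
    [FiniteDimensional C A] : Finite (A →ₐ[C] C) :=
  (linearIndependent_algHom_toLinearMap C A C).finite_of_isNoetherian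

/-- **Only finitely many systems of eigenvalues of common eigenvectors occur in a
finite-dimensional space**, for ANY family `(S i)_{i ∈ ι}` of endomorphisms: the system `χ` of a
common eigenvector is read off its eigencharacter `ψ : C[S] → C` (`χ i = ψ (S i)`), and the
finite-dimensional algebra `C[S] ⊆ End_C H` has finitely many characters. [folklore] -/
theorem finite_setOf_common_eigensystem [FiniteDimensional C H] {ι : Type*}
    (S : ι → Module.End C H) :
    {χ : ι → C | ∃ y : H, y ≠ 0 ∧ ∀ i, S i y = χ i • y}.Finite := by
  set A : Subalgebra C (Module.End C H) := Algebra.adjoin C (Set.range S) with hA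
  haveI : FiniteDimensional C A :=
    Module.Finite.of_injective A.val.toLinearMap Subtype.val_injective
  haveI : Finite (A →ₐ[C] C) := finite_algHom_of_finiteDimensional A
  have hmem : ∀ i, S i ∈ A := fun i ↦ Algebra.subset_adjoin ⟨i, rfl⟩
  refine (Set.finite_range fun (ψ : A →ₐ[C] C) (i : ι) ↦ ψ ⟨S i, hmem i⟩).subset ?_
  rintro χ ⟨y, hy, h⟩
  obtain ⟨ψ, -, hψ⟩ := exists_algHom_apply_eq_smul_of_common_eigenvector S χ hy h
  exact ⟨ψ, funext fun i ↦ hψ i (hmem i)⟩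

end Eigencharacter

/-! ### Semilinear transport of eigensystems -/

section Semilinear

variable {C : Type*} [Field C] {H : Type*} [AddCommGroup H] [Module C H]

/-- **Semilinear transport of a system of eigenvalues.** If `θ : H → H` is `σ`-semilinear and
commutes with every `S i`, and `S i y = χ i • y` for all `i`, then `S i (θ y) = σ (χ i) • θ y`: the
image of a common eigenvector is a common eigenvector with the conjugate system `σ ∘ χ` (the
mechanism of `^σΠ`, Grobner–Raghuram 2014, Def. 43 and Thm. 50; Clozel 1990, §3.1).
[cite: GrobnerRaghuram2014, Thm. 50 (arXiv:1102.1872 numbering)] -/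
theorem apply_semilinear_eq_smul {ι : Type*} (S : ι → Module.End C H) (χ : ι → C) {y : H}
    (h : ∀ i, S i y = χ i • y) {σ : C →+* C} (θ : H →ₛₗ[σ] H)
    (hθ : ∀ (i : ι) (z : H), θ (S i z) = S i (θ z)) (i : ι) :
    S i (θ y) = σ (χ i) • θ y := by
  rw [← hθ, h i, LinearMap.map_smulₛₗ]

/-- **Finitely many conjugates of the system of a common eigenvector.** In a finite-dimensional `H`,
let `y ≠ 0` be a common eigenvector of the `S i` with system `χ`, and let `(θ_g)_{g ∈ G}` be
injective `σ_g`-semilinear maps `H → H` commuting with every `S i`. Then the set of conjugate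
systems `{σ_g ∘ χ : g ∈ G}` is finite (each is the system of the common eigenvector `θ_g y ≠ 0`,
`finite_setOf_common_eigensystem`). [cite: GrobnerRaghuram2014, Thm. 50 (arXiv:1102.1872 numbering)] -/
theorem finite_range_comp_eigensystem [FiniteDimensional C H] {ι : Type*}
    (S : ι → Module.End C H) (χ : ι → C) {y : H} (hy : y ≠ 0) (h : ∀ i, S i y = χ i • y)
    {G : Type*} (σ : G → (C →+* C)) (θ : ∀ g : G, H →ₛₗ[σ g] H)
    (hθS : ∀ (g : G) (i : ι) (z : H), θ g (S i z) = S i (θ g z))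
    (hθinj : ∀ g : G, Function.Injective (θ g)) :
    (Set.range fun g : G ↦ (σ g : C → C) ∘ χ).Finite := by
  refine (finite_setOf_common_eigensystem S).subset ?_
  rintro _ ⟨g, rfl⟩
  refine ⟨θ g y, fun h0 ↦ hy (hθinj g (by rw [h0, map_zero])), fun i ↦ ?_⟩
  change S i (θ g y) = σ g (χ i) • θ g y
  exact apply_semilinear_eq_smul S χ h (θ g) (hθS g) i

end Semilinear

/-! ### Finite-index stabilisers -/

section Stabilizer

/-- **A map out of a group which is constant exactly on the left cosets of a subgroup and has
finite range forces the subgroup to have finite index** (it induces an injection of the coset space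
into the range). [folklore] -/
theorem finiteIndex_of_finite_range {G : Type*} [Group G] (Hs : Subgroup G) {X : Type*}
    (f : G → X) (hf : ∀ g g' : G, f g = f g' ↔ g⁻¹ * g' ∈ Hs) (hfin : (Set.range f).Finite) :
    Hs.FiniteIndex := by
  haveI : Finite (Set.range f) := hfin.to_subtype
  let φ : G ⧸ Hs → Set.range f := Quotient.lift (s := QuotientGroup.leftRel Hs)
    (fun g ↦ ⟨f g, g, rfl⟩) (fun g g' hgg' ↦
      Subtype.ext ((hf g g').mpr (QuotientGroup.leftRel_apply.mp hgg')))
  haveI : Finite (G ⧸ Hs) := by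
    refine Finite.of_injective φ ?_
    intro a b hab
    induction a using Quotient.inductionOn with
    | h g =>
      induction b using Quotient.inductionOn with
      | h g' =>
        have hgg' : f g = f g' := congrArg Subtype.val hab
        exact Quotient.sound (QuotientGroup.leftRel_apply.mpr ((hf g g').mp hgg'))
  exact Subgroup.finiteIndex_of_finite_quotient

variable {C : Type*} [Field C] {H : Type*} [AddCommGroup H] [Module C H]

/-- **The stabiliser of the system of a common eigenvector has finite index.** Let a group `G` act
on the field `C` through ring endomorphisms `σ_g` (`σ_1 = id`, `σ_{gg'} = σ_g ∘ σ_{g'}`) and on the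
finite-dimensional `C`-space `H` through injective `σ_g`-semilinear maps `θ_g` commuting with every
`S i`. If `y ≠ 0` is a common eigenvector of the `S i` with system `χ`, then the stabiliser
`{g ∈ G | σ_g (χ i) = χ i for all i}` is a subgroup of finite index in `G`: `g ↦ σ_g ∘ χ` is
constant exactly on its left cosets and has finite range (`finite_range_comp_eigensystem`). This is
the abstract form of "the stabiliser of `Π_f` in `Aut(ℂ)` has finite index" (Grobner–Raghuram 2014,
proof of Thm. 50; Clozel 1990, §3.1). [cite: GrobnerRaghuram2014, Thm. 50 (arXiv:1102.1872 numbering)] -/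
theorem exists_stabilizer_finiteIndex_of_semilinear [FiniteDimensional C H] {ι : Type*}
    (S : ι → Module.End C H) (χ : ι → C) {y : H} (hy : y ≠ 0) (h : ∀ i, S i y = χ i • y)
    {G : Type*} [Group G] (σ : G → (C →+* C)) (hσ_one : ∀ c : C, σ 1 c = c)
    (hσ_mul : ∀ (g g' : G) (c : C), σ (g * g') c = σ g (σ g' c))
    (θ : ∀ g : G, H →ₛₗ[σ g] H) (hθS : ∀ (g : G) (i : ι) (z : H), θ g (S i z) = S i (θ g z))
    (hθinj : ∀ g : G, Function.Injective (θ g)) :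
    ∃ Hs : Subgroup G, (∀ g : G, g ∈ Hs ↔ ∀ i, σ g (χ i) = χ i) ∧ Hs.FiniteIndex := by
  -- `σ_{g⁻¹}` undoes `σ_g`
  have hσ_inv : ∀ (g : G) (c : C), σ g⁻¹ (σ g c) = c := fun g c ↦ by
    rw [← hσ_mul, inv_mul_cancel, hσ_one]
  let Hs : Subgroup G :=
    { carrier := {g | ∀ i, σ g (χ i) = χ i}
      one_mem' := fun i ↦ hσ_one (χ i)
      mul_mem' := fun {g g'} hg hg' i ↦ by rw [hσ_mul, hg' i, hg i]
      inv_mem' := fun {g} hg i ↦ by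
        conv_lhs => rw [← hg i]
        exact hσ_inv g (χ i) }
  have hmem : ∀ g : G, g ∈ Hs ↔ ∀ i, σ g (χ i) = χ i := fun g ↦ Iff.rfl
  refine ⟨Hs, hmem, finiteIndex_of_finite_range Hs (fun g : G ↦ (σ g : C → C) ∘ χ) ?_
    (finite_range_comp_eigensystem S χ hy h σ θ hθS hθinj)⟩
  intro g g'
  rw [hmem]
  constructor
  · intro hgg' i
    have h1 : σ g (χ i) = σ g' (χ i) := congrFun hgg' i
    rw [hσ_mul, ← h1, hσ_inv]
  · intro hgg'
    funext i
    have h1 := hgg' i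
    simp only [Function.comp_apply]
    conv_rhs => rw [← mul_inv_cancel_left g g', hσ_mul, h1]

end Stabilizer

end Literature.LinearAlgebra.Semilinear

end
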